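import Mathlib
import HarnessLib
import Summits.AtomisticToContinuum.FouriersLaw.Theses.ContactStieltjesMeasure
import Summits.AtomisticToContinuum.FouriersLaw.Theses.BoundaryEscapeDeficit
import Summits.AtomisticToContinuum.FouriersLaw.Theses.OddSectorIrreversibility
import Summits.AtomisticToContinuum.FouriersLaw.Theorems.ContactStieltjesMeasureContactMeasureLimitComposition

/-!
# Crux `ContactMeasureLimit` (stmt-AtomisticToContinuum-15250) — line `IdeatorOneSketch`
# (idea `escaped-mass-stieltjes-constant`) run over the registered `escape-import` composition — skeleton v3

Lead prover skeleton (2026-08-17). The crux (M): for every family `Φ_N` of contact distribution functions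
REPRESENTING the two-terminal response of `pinnedChain ω₂ lam β ·` at `T` and every friction `γ`, the scaled
functions `N·Φ_N` converge at the continuity points `t > 0` of a monotone `M`.

STATUS (v3): EVERYTHING EXCEPT THE TWO PHYSICS ITEMS IS LANDED in `Summits/AtomisticToContinuum/FouriersLaw/Theorems/`
(namespace `Summit.AtomisticToContinuum.FouriersLaw.Theorems.ContactMeasureLimit`), all `--supports stmt-15250`:
* analysis stubs — `…StubLayerCake` (p159123, `stub_layerCake`: Tonelli `∫(γ²+s²)⁻¹dμ_G = ∫₀^∞ G k_γ`),
  `…StubTruncatedConvergence` (p158902), `…StubEscapedMassConstant` (p159369: the escaped contact mass is a `γ`-free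
  constant), `…StubLimitRepresentation` (p159077: Stieltjes data `(e, ν_G)` in the tree's class `N_S`);
* glue — `…AprioriBound` (p159788: one-friction bound `F(t) ≤ (γ²+t²)∫F k_γ`), `…Helly` (p159769: Helly with local
  bounds over the tree's diagonal extraction), `…SqMeasure` (p159783: equal squared measures ⇒ equal values at
  continuity points), `…LimitData` (p159968: `limitData` + `limitData_unique` over `stieltjes_data_unique` /
  `eqOn_of_hasStieltjesRepresentation_of_eqOn_neg`), `…StieltjesContinuity` (p160184: THE ANALYSIS CHILD
  `stieltjesContinuity`, = the old registered stub `stub_stieltjesContinuity` of lines `birth`/`escape-import`, PROVED),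
  `…Composition` (p160394: `scaledTransforms_tendsto_of_items`, `tendsto_scaled_of_transforms`,
  `contactMeasureLimit_of_items : EscapeNonOscillation → BoundedResponse → ContactMeasureLimit`).
So the crux is CLOSED MODULO items stmt-12238 `BoundaryEscapeDeficit.EscapeNonOscillation` and stmt-10924
`OddSectorIrreversibility.BoundedResponse`, which are the two remaining stubs below, BY NAME.
(v1/v2 of this skeleton, with the full analysis inline, are kept in the lead's folder: work/ContactMeasureLimit.v2.lean.)

`sorry` occurs only inside `stub_*`.
-/

noncomputable section

namespace Summit.AtomisticToContinuum.FouriersLaw.Cruxes.ContactMeasureLimit.EscapedMass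

open Summit.AtomisticToContinuum.FouriersLaw.Theses

/-! ## The stubs (`sorry` lives only here) — both are EXISTING ITEMS of sibling routes, taken by name -/

/-- stub P1 — NO OSCILLATION of the escape deficit: item stmt-AtomisticToContinuum-12238 BY NAME
(`N ↦ (N−1)·γ·E_N` has a limit in `EReal`; open crux of route `BoundaryEscapeDeficit`, own line
`Cruxes/EscapeNonOscillation/Lines/birth.lean`). -/
theorem stub_escapeNonOscillation : BoundaryEscapeDeficit.EscapeNonOscillation := by
  sorry

/-- stub P2 — BOUNDED RESPONSE: item stmt-AtomisticToContinuum-10924 BY NAME (the catalogued barrier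
`HasBoundedResponse` as a typed item; on this route a corollary of K2 ∧ (U)). -/
theorem stub_boundedResponse : OddSectorIrreversibility.BoundedResponse := by
  sorry

/-! ## The composition -/

/-- ASSEMBLY (A12 skeleton shape): the crux `ContactMeasureLimit`, concluded BY NAME from the two physics stubs BY
NAME through the LANDED composition `Theorems.ContactMeasureLimit.contactMeasureLimit_of_items` (p160394), whose
analysis child `stieltjesContinuity` (p160184) is a theorem of the tree. -/
theorem ContactMeasureLimit_of :
    Summit.AtomisticToContinuum.FouriersLaw.Theses.ContactStieltjesMeasure.ContactMeasureLimit :=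
  Summit.AtomisticToContinuum.FouriersLaw.Theorems.ContactMeasureLimit.contactMeasureLimit_of_items
    stub_escapeNonOscillation stub_boundedResponse

end Summit.AtomisticToContinuum.FouriersLaw.Cruxes.ContactMeasureLimit.EscapedMass

end
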